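import Mathlib.CategoryTheory.Triangulated.Orthogonal
import Mathlib.CategoryTheory.ObjectProperty.Shift
import Mathlib.CategoryTheory.Linear.Basic
import Mathlib.CategoryTheory.Adjunction.Basic
import Mathlib.LinearAlgebra.Dual.Defs

/-!
# Kuznetsov (residual) components, semiorthogonal decompositions, Serre functors,
# Calabi–Yau categories

The categorical vocabulary needed to *state* results about the Kuznetsov component
`Ku(X) = ⟨𝒪_X, 𝒪_X(1), …, 𝒪_X(n+1-d)⟩^⊥ ⊂ Dᵇ(X)` of a smooth Fano hypersurface
`X ⊂ ℙⁿ⁺¹` of degree `d ≤ n + 2` [Kuznetsov2017, Cor. 4.1] and about Calabi–Yau categories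
[Kuznetsov2017, Def. 1.1], on top of Mathlib's pretriangulated categories
(`CategoryTheory.Pretriangulated`), triangulated subcategories as object properties
(`ObjectProperty.IsTriangulated`) and orthogonals (`ObjectProperty.rightOrthogonal`).

## Main definitions (namespace `Literature.AlgebraicGeometry.DerivedCategories`)

* `kuznetsovComponent E` — for a family of objects `E : ι → C` of a pretriangulated category,
  the right orthogonal `⟨E i | i⟩^⊥ = {F | Hom(E i⟦t⟧, F) = 0 for all i, t}` as an
  `ObjectProperty C`; it is a strictly full triangulated subcategory (instances below).
  `KuznetsovComponent E` is the same thing as a category (a full subcategory of `C`), which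
  inherits `Pretriangulated`, the shift and the `k`-linear structure from Mathlib.
  For `C = Dᵇ(X)`, `X ⊂ ℙⁿ⁺¹` a smooth hypersurface of degree `d`, `ι = Fin (n + 2 - d)` and
  `E i = 𝒪_X(i)` this is `Ku(X)` [Kuznetsov2017, Cor. 4.1], e.g. for a cubic fourfold
  `Dᵇ(X) = ⟨Ku(X), 𝒪_X, 𝒪_X(1), 𝒪_X(2)⟩` [Perry2022, Ex. 6.7 (arXiv numbering)].
* `IsExceptional k E`, `IsExceptionalCollection k E` [Kuznetsov2014, §1.1].
* `IsLeftAdmissible`, `IsRightAdmissible`, `IsAdmissible` (the inclusion of a full subcategory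
  has a left / right / both adjoints) [Kuznetsov2014, §1.1], [Kuznetsov2017, §2.2].
* `filteredBy A`, `IsSemiorthogonalDecomposition A` for `A : Fin m → ObjectProperty C`
  [Kuznetsov2017, Def. 2.1].
* `SerreDuality k S`, `IsSerreFunctor k S`, `HasSerreFunctor k C` [Kuznetsov2017, Def. 2.5]
  (originally Bondal–Kapranov 1989), `IsCalabiYau k C n` [Kuznetsov2017, Def. 1.1],
  `IsFractionalCalabiYau k C` [Kuznetsov2017, Def. 1.2].

## Design

Everything here is an honest definition with a body plus elementary API; nothing is postulated.
The Kuznetsov component is a CONSTRUCTION from the data `(C, E)`; which `(C, E)` models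
`(Dᵇ(X), (𝒪_X(i))_i)` for an actual variety `X` is not expressible yet (see below), so
statements such as "`Ku(X)` is a Calabi–Yau category of dimension `(n+2)(d-2)/d` when
`d ∣ n + 2`" [Kuznetsov2017, Cor. 4.1] are to be phrased by consumers as hypotheses
`IsCalabiYau k (KuznetsovComponent E) N` on abstract data.

## Deliberately NOT here

* `Dᵇ(Coh X)` of a scheme, the twisting sheaves `𝒪_X(i)` and hence the *geometric* `Ku(X)`:
  Mathlib (v4.32 pin) has `DerivedCategory` of an abelian category but no coherent sheaves /
  Serre twists on `Proj`; the tree's hypersurfaces (`Motives.IsSmoothHypersurface`) carry no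
  sheaf theory. Consequently Kuznetsov's Corollary 4.1 (semiorthogonal decomposition of `Dᵇ(X)`
  and the fractional Calabi–Yau property of `Ku(X)`) is NOT vendored as a named fact: its
  subject cannot be named faithfully yet.
* Bondal's theorem that an exceptional collection in a proper triangulated category generates an
  admissible subcategory (so that `C = ⟨Ku, E₀, …, E_m⟩` is a semiorthogonal decomposition),
  mutation functors, Serre functors of semiorthogonal components [Kuznetsov2017, Lem. 2.7].
* dg-enhancements, Hochschild (co)homology, topological K-theory of `Ku(X)` (Perry2022 §5).

## References

* [Kuznetsov2017] A. Kuznetsov, *Calabi–Yau and fractional Calabi–Yau categories*, J. reine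
  angew. Math. 753 (2019); arXiv:1509.07657 (theorem numbering of the arXiv version).
* [Kuznetsov2014] A. Kuznetsov, *Semiorthogonal decompositions in algebraic geometry*, ICM 2014.
* [Perry2022] A. Perry, *The integral Hodge conjecture for two-dimensional Calabi–Yau
  categories*, Compositio Math. 158 (2022); arXiv:2004.03163.
-/

namespace Literature.AlgebraicGeometry.DerivedCategories

open CategoryTheory CategoryTheory.Limits CategoryTheory.Pretriangulated
open CategoryTheory.ObjectProperty ZeroObject

universe w' w v u

/-! ### Right orthogonals of families of objects; the Kuznetsov component -/

section Shift

variable {C : Type u} [Category.{v} C] [Preadditive C] [HasShift C ℤ]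

/-- The **Kuznetsov (residual) component** of a family of objects `E : ι → C` of a
pretriangulated category `C`: the right orthogonal
`⟨E i | i ∈ ι⟩^⊥ := {F ∈ C | Hom(E i⟦t⟧, F) = 0 for all i ∈ ι, t ∈ ℤ}` [Kuznetsov2014, §1.1,
eq. for `𝒜^⊥`], [Kuznetsov2017, §2.2], realised as Mathlib's `rightOrthogonal` of the closure of
`{E i}` under shifts and isomorphisms. When `E` is an exceptional collection this is the component
`𝒜` of the semiorthogonal decomposition `C = ⟨𝒜, E_1, …, E_m⟩` [Kuznetsov2014, §1.1]; for
`C = Dᵇ(X)`, `X ⊂ ℙⁿ⁺¹` a smooth hypersurface of degree `d ≤ n + 2`, and `E i = 𝒪_X(i)`,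
`0 ≤ i ≤ n + 1 - d`, it is `Ku(X) = 𝒜_X` [Kuznetsov2017, Cor. 4.1]. The definition itself does not
require `E` to be exceptional. [cite: Kuznetsov2014, §1.1] -/
def kuznetsovComponent {ι : Type w} (E : ι → C) : ObjectProperty C :=
  ((ofObj E).shiftClosure ℤ).rightOrthogonal

variable {ι : Type w} (E : ι → C)

/-- Unfolding of `kuznetsovComponent`. [folklore] -/
theorem kuznetsovComponent_def :
    kuznetsovComponent E = ((ofObj E).shiftClosure ℤ).rightOrthogonal := rfl

/-- `F ∈ ⟨E i⟩^⊥` iff every morphism `E i⟦n⟧ ⟶ F` vanishes. [cite: Kuznetsov2014, §1.1] -/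
theorem kuznetsovComponent_iff (F : C) :
    kuznetsovComponent E F ↔ ∀ (i : ι) (n : ℤ) (f : (E i)⟦n⟧ ⟶ F), f = 0 := by
  constructor
  · intro hF i n f
    exact hF f ⟨E i, n, Iso.refl _, ⟨i⟩⟩
  · rintro hF X f ⟨_, n, e, ⟨i⟩⟩
    rw [← cancel_epi e.inv, comp_zero]
    exact hF i n _

/-- Morphisms from the generating objects into the Kuznetsov component vanish. [folklore] -/
theorem kuznetsovComponent.hom_eq_zero {E} {F : C} (hF : kuznetsovComponent E F) (i : ι)
    (f : E i ⟶ F) : f = 0 :=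
  let e : E i ≅ (E i)⟦(0 : ℤ)⟧ := ((shiftFunctorZero C ℤ).app (E i)).symm
  hF f ⟨E i, 0, e, ⟨i⟩⟩

/-- The Kuznetsov component is a strictly full subcategory. [folklore] -/
instance kuznetsovComponent.isClosedUnderIsomorphisms :
    (kuznetsovComponent E).IsClosedUnderIsomorphisms := by
  rw [kuznetsovComponent_def]; infer_instance

/-- The Kuznetsov component is stable under all shifts. [folklore] -/
instance kuznetsovComponent.isStableUnderShift :
    (kuznetsovComponent E).IsStableUnderShift ℤ := by
  rw [kuznetsovComponent_def]; infer_instance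

/-- With no generating objects the Kuznetsov component is everything. [folklore] -/
theorem kuznetsovComponent_of_isEmpty [IsEmpty ι] : kuznetsovComponent E = ⊤ := by
  ext F
  simp [kuznetsovComponent_iff]

/-! ### Exceptional objects and collections -/

section Linear

variable (k : Type w') [CommRing k] [Linear k C]

/-- An object `E` of a `k`-linear pretriangulated category is **exceptional** if
`Hom(E, E) = k` (i.e. `a ↦ a • 𝟙 E` is a bijection `k → End E`) and `Hom(E, E⟦t⟧) = 0` for all
`t ≠ 0`. [cite: Kuznetsov2014, §1.1] -/
def IsExceptional (E : C) : Prop :=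
  Function.Bijective (fun a : k => a • 𝟙 E) ∧ ∀ n : ℤ, n ≠ 0 → ∀ f : E ⟶ E⟦n⟧, f = 0

/-- An **exceptional collection** indexed by a preorder `ι` (a sequence `E_1, …, E_m` when
`ι = Fin m`): every `E i` is exceptional and `Hom(E i, E j⟦t⟧) = 0` for all `i > j` and all
`t ∈ ℤ`. [cite: Kuznetsov2014, §1.1] -/
def IsExceptionalCollection {ι : Type w} [Preorder ι] (E : ι → C) : Prop :=
  (∀ i, IsExceptional k (E i)) ∧ ∀ ⦃i j : ι⦄, j < i → ∀ (n : ℤ) (f : E i ⟶ (E j)⟦n⟧), f = 0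

variable {k}

/-- Members of an exceptional collection are exceptional. [folklore] -/
theorem IsExceptionalCollection.isExceptional {ι : Type w} [Preorder ι] {E : ι → C}
    (h : IsExceptionalCollection k E) (i : ι) : IsExceptional k (E i) := h.1 i

/-- Semiorthogonality of an exceptional collection: no maps backwards. [folklore] -/
theorem IsExceptionalCollection.hom_eq_zero {ι : Type w} [Preorder ι] {E : ι → C}
    (h : IsExceptionalCollection k E) {i j : ι} (hij : j < i) (f : E i ⟶ E j) : f = 0 := by
  let e : E j ≅ (E j)⟦(0 : ℤ)⟧ := ((shiftFunctorZero C ℤ).app (E j)).symm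
  have h₁ : f ≫ e.hom = 0 := h.2 hij 0 (f ≫ e.hom)
  have h₂ : f = (f ≫ e.hom) ≫ e.inv := by simp
  rw [h₂, h₁, zero_comp]

end Linear

end Shift

section AdditiveShift

variable {C : Type u} [Category.{v} C] [Preadditive C] [HasShift C ℤ]
  [∀ n : ℤ, (shiftFunctor C n).Additive]

/-- When the shift functors are additive, `Hom(X⟦n⟧, Y) = 0` iff `Hom(X, Y⟦m⟧) = 0` whenever
`n + m = 0` (transport along the shift auto-equivalence). [folklore] -/
theorem forall_shift_hom_eq_zero_iff (X Y : C) (n m : ℤ) (h : n + m = 0) :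
    (∀ f : X⟦n⟧ ⟶ Y, f = 0) ↔ ∀ g : X ⟶ Y⟦m⟧, g = 0 := by
  constructor
  · intro hf g
    obtain ⟨f, rfl⟩ := ((shiftEquiv' C n m h).toAdjunction.homEquiv X Y).surjective g
    rw [Adjunction.homEquiv_unit, hf f]
    change _ ≫ (shiftFunctor C m).map 0 = 0
    simp
  · intro hg f
    obtain ⟨g, rfl⟩ := ((shiftEquiv' C n m h).toAdjunction.homEquiv X Y).symm.surjective f
    rw [Adjunction.homEquiv_counit, hg g]
    change (shiftFunctor C n).map 0 ≫ _ = 0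
    simp

variable {ι : Type w} (E : ι → C)

/-- `F ∈ ⟨E i⟩^⊥` iff `Hom(E i, F⟦n⟧) = 0` for all `i` and `n`, i.e. `RHom(E i, F) = 0`.
[cite: Kuznetsov2014, §1.1] -/
theorem kuznetsovComponent_iff' (F : C) :
    kuznetsovComponent E F ↔ ∀ (i : ι) (n : ℤ) (f : E i ⟶ F⟦n⟧), f = 0 := by
  rw [kuznetsovComponent_iff]
  constructor
  · intro hF i n
    exact (forall_shift_hom_eq_zero_iff (E i) F (-n) n (by omega)).1 (hF i (-n))
  · intro hF i n
    exact (forall_shift_hom_eq_zero_iff (E i) F n (-n) (by omega)).2 (hF i (-n))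

end AdditiveShift

section Pretriangulated

variable {C : Type u} [Category.{v} C] [HasZeroObject C] [HasShift C ℤ] [Preadditive C]
  [∀ n : ℤ, (shiftFunctor C n).Additive] [Pretriangulated C]

variable {ι : Type w} (E : ι → C)

/-- The Kuznetsov component is a triangulated subcategory (closed under shifts and extensions,
contains `0`): the right orthogonal of a shift-stable class is triangulated, by the long exact
`Hom` sequence. [cite: Kuznetsov2014, §1.1] -/
instance kuznetsovComponent.isTriangulated : (kuznetsovComponent E).IsTriangulated := by
  rw [kuznetsovComponent_def]; infer_instance

/-- The Kuznetsov component `⟨E i⟩^⊥` as a category in its own right: the full subcategory of `C`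
it spans. Through Mathlib it is pretriangulated (`ObjectProperty.FullSubcategory` of a
triangulated object property), carries the induced shift, and is `k`-linear when `C` is, so that
e.g. `IsCalabiYau k (KuznetsovComponent E) 2` ("`Ku` is a K3 = CY₂ category", cubic fourfolds)
or `… 4` (cubic tenfolds, quartic sixfolds [Kuznetsov2017, Cor. 4.1]) are well-formed statements.
[folklore] -/
abbrev KuznetsovComponent := (kuznetsovComponent E).FullSubcategory

/-! ### Admissible subcategories and semiorthogonal decompositions -/

/-- Objects admitting a filtration with subquotients in the pieces `A 0, …, A (m-1)`
(condition (2) of [Kuznetsov2017, Def. 2.1], with pieces numbered from `0`): a chain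
`0 = T_m ⟶ T_{m-1} ⟶ ⋯ ⟶ T_1 ⟶ T_0 = T` with `Cone(T_{i+1} ⟶ T_i) ∈ A i`. Stated by recursion on
`m`: for `m = 0` the object is zero; for `m + 1` pieces there is a distinguished triangle
`T_1 ⟶ T ⟶ Z ⟶ T_1⟦1⟧` with `Z ∈ A 0` and `T_1` filtered by `A 1, …, A m`
(Mathlib's `ObjectProperty.extensionProduct`). [cite: Kuznetsov2017, Def. 2.1] -/
def filteredBy : {m : ℕ} → (Fin m → ObjectProperty C) → ObjectProperty C
  | 0, _ => fun T => IsZero T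
  | _ + 1, A => extensionProduct (filteredBy fun i => A i.succ) (A 0)

/-- Unfolding of `filteredBy` with no pieces. [folklore] -/
@[simp] theorem filteredBy_zero (A : Fin 0 → ObjectProperty C) (T : C) :
    filteredBy A T ↔ IsZero T := Iff.rfl

/-- Unfolding of `filteredBy` with `m + 1` pieces. [folklore] -/
theorem filteredBy_succ {m : ℕ} (A : Fin (m + 1) → ObjectProperty C) :
    filteredBy A = extensionProduct (filteredBy fun i => A i.succ) (A 0) := rfl

/-- A full subcategory `P ⊂ C` is **left admissible** if its inclusion functor `P.ι` has a left
adjoint (standard terminology going back to Bondal and Bondal–Kapranov; [Kuznetsov2014, §1.1]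
uses only the two-sided notion `IsAdmissible`). [folklore] -/
def IsLeftAdmissible {D : Type u} [Category.{v} D] (P : ObjectProperty D) : Prop :=
  P.ι.IsRightAdjoint

/-- A full subcategory `P ⊂ C` is **right admissible** if its inclusion functor `P.ι` has a right
adjoint (see `IsLeftAdmissible`). [folklore] -/
def IsRightAdmissible {D : Type u} [Category.{v} D] (P : ObjectProperty D) : Prop :=
  P.ι.IsLeftAdjoint

/-- A full subcategory `P ⊂ C` is **admissible** if its inclusion functor has both a left and a
right adjoint [Kuznetsov2014, §1.1], [Kuznetsov2017, §2.2]. [cite: Kuznetsov2014, §1.1] -/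
def IsAdmissible {D : Type u} [Category.{v} D] (P : ObjectProperty D) : Prop :=
  IsLeftAdmissible P ∧ IsRightAdmissible P

/-- A **semiorthogonal decomposition** `C = ⟨A 0, A 1, …, A (m-1)⟩` of a pretriangulated category:
a finite sequence of strictly full triangulated subcategories such that
(1) `Hom(A i, A j) = 0` for all `i > j`, and (2) every object admits a filtration
`0 = T_m ⟶ ⋯ ⟶ T_1 ⟶ T_0 = T` with `Cone(T_{i+1} ⟶ T_i) ∈ A i` (`filteredBy`). This is
[Kuznetsov2017, Def. 2.1] with pieces numbered from `0` (`A i` here is `𝒜_{i+1}` there); "full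
triangulated subcategory" is read as strictly full (closed under isomorphisms).
[cite: Kuznetsov2017, Def. 2.1] -/
structure IsSemiorthogonalDecomposition {m : ℕ} (A : Fin m → ObjectProperty C) : Prop where
  /-- each piece is a triangulated subcategory -/
  isTriangulated (i : Fin m) : (A i).IsTriangulated
  /-- each piece is strictly full -/
  isClosedUnderIsomorphisms (i : Fin m) : (A i).IsClosedUnderIsomorphisms
  /-- semiorthogonality: no morphisms from later pieces to earlier ones -/
  hom_eq_zero ⦃i j : Fin m⦄ (hij : j < i) ⦃X Y : C⦄ (hX : A i X) (hY : A j Y) (f : X ⟶ Y) : f = 0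
  /-- generation: every object is filtered with subquotients in the pieces -/
  filtered (T : C) : filteredBy A T

/-- In a semiorthogonal decomposition an earlier piece lies in the right orthogonal of every later
piece. [folklore] -/
theorem IsSemiorthogonalDecomposition.le_rightOrthogonal {m : ℕ} {A : Fin m → ObjectProperty C}
    (h : IsSemiorthogonalDecomposition A) {i j : Fin m} (hij : j < i) :
    A j ≤ (A i).rightOrthogonal :=
  fun _ hY _ f hX => h.hom_eq_zero hij hX hY f

/-- The whole category is a triangulated subcategory of itself. [folklore] -/
theorem top_isTriangulated : (⊤ : ObjectProperty C).IsTriangulated where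
  ext₂' _ _ _ _ := le_isoClosure _ _ trivial

/-- Non-vacuity: `C = ⟨C⟩` is a semiorthogonal decomposition with one piece. [folklore] -/
theorem isSemiorthogonalDecomposition_top :
    IsSemiorthogonalDecomposition (fun _ : Fin 1 => (⊤ : ObjectProperty C)) where
  isTriangulated _ := top_isTriangulated
  isClosedUnderIsomorphisms _ := inferInstance
  hom_eq_zero i j hij _ _ _ _ _ := by omega
  filtered T := by
    rw [filteredBy_succ, extensionProduct_iff]
    exact ⟨0, T, 0, 𝟙 T, 0, contractible_distinguished₁ T,
      (filteredBy_zero _ _).2 (isZero_zero C), trivial⟩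

end Pretriangulated

/-! ### Serre functors and (fractional) Calabi–Yau categories -/

section Serre

variable (k : Type w') [CommRing k] {D : Type u} [Category.{v} D]

/-- Iterated composition `S^q = S ⋙ ⋯ ⋙ S` (`q` factors; `S^0 = 𝟭`). [folklore] -/
def compPow (S : D ⥤ D) : ℕ → (D ⥤ D)
  | 0 => 𝟭 D
  | q + 1 => compPow S q ⋙ S

/-- `S^(q+1) = S^q ⋙ S` (and `S^0 = 𝟭` by `rfl`). [folklore] -/
theorem compPow_succ (S : D ⥤ D) (q : ℕ) : compPow S (q + 1) = compPow S q ⋙ S := rfl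

variable [Preadditive D] [Linear k D]

/-- **Serre duality data** for an endofunctor `S` of a `k`-linear category: a bifunctorial
`k`-linear isomorphism `Hom(Y, S X) ≅ Hom(X, Y)^∨` [Kuznetsov2017, Def. 2.5] (Bondal–Kapranov).
Bifunctoriality is spelled out on the associated pairing
`⟪f, φ⟫ := homEquiv X Y φ f` (`f : X ⟶ Y`, `φ : Y ⟶ S X`): `⟪f, g ≫ φ⟫ = ⟪f ≫ g, φ⟫` and
`⟪f, φ ≫ S h⟫ = ⟪h ≫ f, φ⟫`. [cite: Kuznetsov2017, Def. 2.5] -/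
structure SerreDuality (S : D ⥤ D) where
  /-- the isomorphism `Hom(Y, S X) ≃ₗ[k] Hom(X, Y)^∨` -/
  homEquiv (X Y : D) : (Y ⟶ S.obj X) ≃ₗ[k] Module.Dual k (X ⟶ Y)
  /-- naturality in `Y` -/
  homEquiv_comp_left {X Y Y' : D} (g : Y' ⟶ Y) (φ : Y ⟶ S.obj X) (f : X ⟶ Y') :
    homEquiv X Y' (g ≫ φ) f = homEquiv X Y φ (f ≫ g)
  /-- naturality in `X` -/
  homEquiv_comp_map {X X' Y : D} (h : X ⟶ X') (φ : Y ⟶ S.obj X) (f : X' ⟶ Y) :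
    homEquiv X' Y (φ ≫ S.map h) f = homEquiv X Y φ (h ≫ f)

/-- `S` **is a Serre functor**: an auto-equivalence admitting Serre duality data
[Kuznetsov2017, Def. 2.5]; "if a Serre functor exists then it is unique up to a canonical
isomorphism" (loc. cit.). Kuznetsov's standing convention that functors between triangulated
categories are triangulated is not imposed here (no shift is needed to state the notion).
[cite: Kuznetsov2017, Def. 2.5] -/
def IsSerreFunctor (S : D ⥤ D) : Prop :=
  S.IsEquivalence ∧ Nonempty (SerreDuality k S)

/-- The `k`-linear category `D` **has a Serre functor** (a predicate of `k` and `D`).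
[cite: Kuznetsov2017, Def. 2.5] -/
def HasSerreFunctor (D : Type u) [Category.{v} D] [Preadditive D] [Linear k D] : Prop :=
  ∃ S : D ⥤ D, IsSerreFunctor k S

variable (D) in
/-- `D` is an **`n`-Calabi–Yau category**: it has a Serre functor `S` with `S ≅ [n]`
[Kuznetsov2017, Def. 1.1]; `n` is the CY-dimension. Equivalent to "the shift `[n]` is a Serre
functor" (`isCalabiYau_iff`). [cite: Kuznetsov2017, Def. 1.1] -/
def IsCalabiYau [HasShift D ℤ] (n : ℤ) : Prop :=
  ∃ S : D ⥤ D, IsSerreFunctor k S ∧ Nonempty (S ≅ shiftFunctor D n)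

variable (D) in
/-- `D` is a **fractional Calabi–Yau category**: it has a Serre functor `S` and there are
integers `p` and `q ≠ 0` with `S^q ≅ [p]` [Kuznetsov2017, Def. 1.2]. Since `S` is an
auto-equivalence, `S^q ≅ [p]` iff `S^{-q} ≅ [-p]`, so we may and do take `q ≥ 1`.
[cite: Kuznetsov2017, Def. 1.2] -/
def IsFractionalCalabiYau [HasShift D ℤ] : Prop :=
  ∃ S : D ⥤ D, IsSerreFunctor k S ∧
    ∃ (p : ℤ) (q : ℕ), q ≠ 0 ∧ Nonempty (compPow S q ≅ shiftFunctor D p)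

variable {k}

/-- Serre duality data transports along an isomorphism of functors. [folklore] -/
def SerreDuality.ofIso {S S' : D ⥤ D} (d : SerreDuality k S) (e : S ≅ S') :
    SerreDuality k S' where
  homEquiv X Y := (Linear.homCongr k (Iso.refl Y) (e.symm.app X)) ≪≫ₗ d.homEquiv X Y
  homEquiv_comp_left g φ f := by
    simp [Linear.homCongr_apply, d.homEquiv_comp_left]
  homEquiv_comp_map h φ f := by
    simp only [LinearEquiv.trans_apply, Linear.homCongr_apply, Iso.refl_inv,
      Category.id_comp, Iso.app_hom, Iso.symm_hom, Category.assoc]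
    rw [e.inv.naturality h, ← Category.assoc, d.homEquiv_comp_map]

/-- Being a Serre functor is invariant under isomorphism of functors. [folklore] -/
theorem IsSerreFunctor.of_iso {S S' : D ⥤ D} (h : IsSerreFunctor k S) (e : S ≅ S') :
    IsSerreFunctor k S' := by
  obtain ⟨hS, ⟨d⟩⟩ := h
  exact ⟨Functor.isEquivalence_of_iso e, ⟨d.ofIso e⟩⟩

/-- `D` is `n`-Calabi–Yau iff the shift functor `[n]` is a Serre functor. [folklore] -/
theorem isCalabiYau_iff [HasShift D ℤ] (n : ℤ) :
    IsCalabiYau k D n ↔ IsSerreFunctor k (shiftFunctor D n) := by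
  constructor
  · rintro ⟨S, hS, ⟨e⟩⟩
    exact hS.of_iso e
  · intro h
    exact ⟨_, h, ⟨Iso.refl _⟩⟩

/-- An `n`-Calabi–Yau category is fractional Calabi–Yau (`q = 1`, `p = n`). [folklore] -/
theorem IsCalabiYau.isFractionalCalabiYau [HasShift D ℤ] {n : ℤ} (h : IsCalabiYau k D n) :
    IsFractionalCalabiYau k D := by
  obtain ⟨S, hS, ⟨e⟩⟩ := h
  exact ⟨S, hS, n, 1, one_ne_zero, ⟨(Functor.leftUnitor S) ≪≫ e⟩⟩

end Serre

end Literature.AlgebraicGeometry.DerivedCategories
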